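import Mathlib
import Summits.CriticalPhenomena.PercolationContinuityZ3.Theorems.PercNearOneGluingNoHeavyLowerTailOrientedAntipodalHallWordsTwo

/-!
# Conjecture W2 for the transitive triangle reduces to the three-family inequality `MS3′`

Helper file for crux `stmt-CriticalPhenomena-4575` (`NoHeavyLowerTail`, route `PercNearOneGluingNoHeavy`),
new-inequality factory seat `prim-ineq-gen-3` (gen 18).  Everything here is PROVED; no definitions.

CONJECTURE W2 (memo `run/shared/lean/prim/prim-ineq-gen-3/CONJECTURE-W2.md`) is proved in the tree for at most two types
of antipodal bads (`card_le_card_wordsTwo_of_noTwoPath`, `card_add_card_le_card_wordsTwo_of_twoPath`,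
`card_le_card_wordsTwo_of_pattern`).  The first open configuration is the TRANSITIVE TRIANGLE of types
`(a,b), (a,c), (b,c)` (`a, b, c` distinct petals).  This file records two things.

* The LABEL CALCULUS of words of length two (`sdiff_sdiff_coGood`, `inter_coGood`): for bads `X` of type `(i,j)` and `Y` of
  type `(i',j')` the member difference `(S \ X) \ (S \ Y)` is a co-good as soon as `j ≠ i'` and `i ≠ j'`, and the member meet
  `(S \ X) ∩ (S \ Y)` is a co-good as soon as `j ≠ j'` and `i ≠ i'` (memo §2: losses sit exactly where two types touch).
* The REDUCTION (`card_le_card_wordsTwo_of_transitiveTriangle`): for the transitive triangle, the member differences inside the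
  classes `(a,b) ∪ (a,c)` and inside `(a,c) ∪ (b,c)` and the member meets between the classes `(a,b)` and `(b,c)` are ALL co-good
  words of length two; hence the W2 count for such a family follows from the purely extremal inequality on its three member
  families `P, Q, R` (members of the `(a,b)`-, `(a,c)`-, `(b,c)`-bads)
      `#P + #Q + #R ≤ #( (P ∪ Q) \\ (P ∪ Q) ∪ (Q ∪ R) \\ (Q ∪ R) ∪ P ⊼ R )`,
  which is CONJECTURE `MS3′` of this seat (gen 3; open; verified exhaustively on ≤ 4 points and by SAT/random search beyond —
  memo `CONJECTURE-G3.md`).  `card_le_card_wordsTwo_of_transitiveTriangle_of_MS3` is the conditional form taking `MS3′` (for the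
  hypotheses it actually needs: the three member families pairwise disjoint and `p ∩ r ≠ ∅`) as a named hypothesis; by the W2
  socket `exists_injective_good_above_of_wordsTwo` it then yields distinct good representatives.
(prim-ineq-gen-3 gen 18, 2026-08-23.)
-/

namespace Summit.CriticalPhenomena.PercolationContinuityZ3.Theorems

namespace OrientedAntipodalHall

open Finset AntipodalStrongHarris AntipodalStrongHarris.Lab
open scoped FinsetFamily

variable {α : Type*} [DecidableEq α] {k : ℕ}

/-- **Label calculus, differences.**  For bads `X` of type `(iX, jX)` and `Y` of type `(iY, jY)` inside `S` (monotone `f`),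
the member difference `(S \ X) \ (S \ Y)` is a co-good (label `B`, complement label `A`) provided `jX ≠ iY` and `iX ≠ jY`. -/
theorem sdiff_sdiff_coGood (S : Finset α) {f : Finset α → Lab k} (hf : ∀ ⦃U V : Finset α⦄, U ⊆ V → f U ≤ f V)
    {X Y : Finset α} (hXS : X ⊆ S) {iX jX iY jY : Fin k}
    (hXi : f X = petal iX) (hXj : f (S \ X) = petal jX) (hYi : f Y = petal iY) (hYj : f (S \ Y) = petal jY)
    (h₁ : jX ≠ iY) (h₂ : iX ≠ jY) :
    f ((S \ X) \ (S \ Y)) = bot ∧ f (S \ ((S \ X) \ (S \ Y))) = top := by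
  have hGY : (S \ X) \ (S \ Y) ⊆ Y := by
    intro x hx
    rw [mem_sdiff, mem_sdiff, mem_sdiff] at hx
    by_contra h
    exact hx.2 ⟨hx.1.1, h⟩
  have hsupX : X ⊆ S \ ((S \ X) \ (S \ Y)) := by
    intro x hx
    exact mem_sdiff.mpr ⟨hXS hx, fun h => (mem_sdiff.mp (mem_sdiff.mp h).1).2 hx⟩
  have hsupY : S \ Y ⊆ S \ ((S \ X) \ (S \ Y)) := sdiff_subset_sdiff le_rfl hGY
  constructor
  · refine eq_bot_of_le_petal h₁ ?_ ?_
    · rw [← hXj]; exact hf sdiff_subset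
    · rw [← hYi]; exact hf hGY
  · refine eq_top_of_petal_le h₂ ?_ ?_
    · rw [← hXi]; exact hf hsupX
    · rw [← hYj]; exact hf hsupY

/-- **Label calculus, meets.**  For bads `X` of type `(iX, jX)` and `Y` of type `(iY, jY)` inside `S` (monotone `f`), the member
meet `(S \ X) ∩ (S \ Y)` is a co-good provided `jX ≠ jY` and `iX ≠ iY` (doubly different types never lose the meet). -/
theorem inter_coGood (S : Finset α) {f : Finset α → Lab k} (hf : ∀ ⦃U V : Finset α⦄, U ⊆ V → f U ≤ f V)
    {X Y : Finset α} (hXS : X ⊆ S) (hYS : Y ⊆ S) {iX jX iY jY : Fin k}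
    (hXi : f X = petal iX) (hXj : f (S \ X) = petal jX) (hYi : f Y = petal iY) (hYj : f (S \ Y) = petal jY)
    (h₁ : jX ≠ jY) (h₂ : iX ≠ iY) :
    f ((S \ X) ∩ (S \ Y)) = bot ∧ f (S \ ((S \ X) ∩ (S \ Y))) = top := by
  have hsupX : X ⊆ S \ ((S \ X) ∩ (S \ Y)) := by
    intro x hx
    exact mem_sdiff.mpr ⟨hXS hx, fun h => (mem_sdiff.mp (mem_inter.mp h).1).2 hx⟩
  have hsupY : Y ⊆ S \ ((S \ X) ∩ (S \ Y)) := by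
    intro y hy
    exact mem_sdiff.mpr ⟨hYS hy, fun h => (mem_sdiff.mp (mem_inter.mp h).2).2 hy⟩
  constructor
  · refine eq_bot_of_le_petal h₁ ?_ ?_
    · rw [← hXj]; exact hf inter_subset_left
    · rw [← hYj]; exact hf inter_subset_right
  · refine eq_top_of_petal_le h₂ ?_ ?_
    · rw [← hXi]; exact hf hsupX
    · rw [← hYi]; exact hf hsupY

/-- **W2 for the transitive triangle reduces to `MS3′` (instance form).**  `D₁, D₂, D₃` bads of types `(a,b)`, `(a,c)`, `(b,c)`
inside `S` with `a, b, c` distinct, `f` monotone.  If the three MEMBER families `Mᵢ = {S \ X : X ∈ Dᵢ}` satisfy the three-family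
Marica–Schönheim count `#D₁ + #D₂ + #D₃ ≤ #((M₁ ∪ M₂) \\ (M₁ ∪ M₂) ∪ (M₂ ∪ M₃) \\ (M₂ ∪ M₃) ∪ M₁ ⊼ M₃)`, then the co-good words of
length two of `D₁ ∪ D₂ ∪ D₃` are at least `#D₁ + #D₂ + #D₃` many: every set counted on the left is such a word. -/
theorem card_le_card_wordsTwo_of_transitiveTriangle (S : Finset α) {f : Finset α → Lab k}
    (hf : ∀ ⦃U V : Finset α⦄, U ⊆ V → f U ≤ f V) (D₁ D₂ D₃ : Finset (Finset α)) {a b c : Fin k}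
    (hab : a ≠ b) (hac : a ≠ c) (hbc : b ≠ c)
    (h₁S : ∀ X ∈ D₁, X ⊆ S) (h₁i : ∀ X ∈ D₁, f X = petal a) (h₁j : ∀ X ∈ D₁, f (S \ X) = petal b)
    (h₂S : ∀ Y ∈ D₂, Y ⊆ S) (h₂i : ∀ Y ∈ D₂, f Y = petal a) (h₂j : ∀ Y ∈ D₂, f (S \ Y) = petal c)
    (h₃S : ∀ Z ∈ D₃, Z ⊆ S) (h₃i : ∀ Z ∈ D₃, f Z = petal b) (h₃j : ∀ Z ∈ D₃, f (S \ Z) = petal c)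
    (hMS3 : #D₁ + #D₂ + #D₃ ≤
      #(((D₁.image fun X => S \ X) ∪ (D₂.image fun X => S \ X)) \\ ((D₁.image fun X => S \ X) ∪ (D₂.image fun X => S \ X)) ∪
        ((D₂.image fun X => S \ X) ∪ (D₃.image fun X => S \ X)) \\ ((D₂.image fun X => S \ X) ∪ (D₃.image fun X => S \ X)) ∪
        (D₁.image fun X => S \ X) ⊼ (D₃.image fun X => S \ X))) :
    #D₁ + #D₂ + #D₃ ≤ #{G ∈ S.powerset | f G = bot ∧ f (S \ G) = top ∧
      ∃ X ∈ D₁ ∪ D₂ ∪ D₃, ∃ Y ∈ D₁ ∪ D₂ ∪ D₃, G = (S \ X) \ (S \ Y) ∨ G = (S \ X) ∩ (S \ Y)} := by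
  classical
  set M₁ : Finset (Finset α) := D₁.image fun X => S \ X with hM₁
  set M₂ : Finset (Finset α) := D₂.image fun X => S \ X with hM₂
  set M₃ : Finset (Finset α) := D₃.image fun X => S \ X with hM₃
  set T : Finset (Finset α) := {G ∈ S.powerset | f G = bot ∧ f (S \ G) = top ∧
      ∃ X ∈ D₁ ∪ D₂ ∪ D₃, ∃ Y ∈ D₁ ∪ D₂ ∪ D₃, G = (S \ X) \ (S \ Y) ∨ G = (S \ X) ∩ (S \ Y)} with hT
  -- a member difference of two bads whose types satisfy the label conditions lies in `T`
  have hdiff : ∀ X ∈ D₁ ∪ D₂ ∪ D₃, ∀ Y ∈ D₁ ∪ D₂ ∪ D₃, X ⊆ S →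
      (f ((S \ X) \ (S \ Y)) = bot ∧ f (S \ ((S \ X) \ (S \ Y))) = top) → (S \ X) \ (S \ Y) ∈ T := by
    intro X hX Y hY hXS hlab
    rw [hT, mem_filter, mem_powerset]
    exact ⟨sdiff_subset.trans sdiff_subset, hlab.1, hlab.2, X, hX, Y, hY, Or.inl rfl⟩
  have hmeet : ∀ X ∈ D₁ ∪ D₂ ∪ D₃, ∀ Y ∈ D₁ ∪ D₂ ∪ D₃,
      (f ((S \ X) ∩ (S \ Y)) = bot ∧ f (S \ ((S \ X) ∩ (S \ Y))) = top) → (S \ X) ∩ (S \ Y) ∈ T := by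
    intro X hX Y hY hlab
    rw [hT, mem_filter, mem_powerset]
    exact ⟨inter_subset_left.trans sdiff_subset, hlab.1, hlab.2, X, hX, Y, hY, Or.inr rfl⟩
  -- membership of the three classes in the union
  have hD₁ : ∀ X ∈ D₁, X ∈ D₁ ∪ D₂ ∪ D₃ := fun X hX => mem_union_left _ (mem_union_left _ hX)
  have hD₂ : ∀ X ∈ D₂, X ∈ D₁ ∪ D₂ ∪ D₃ := fun X hX => mem_union_left _ (mem_union_right _ hX)
  have hD₃ : ∀ X ∈ D₃, X ∈ D₁ ∪ D₂ ∪ D₃ := fun X hX => mem_union_right _ hX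
  have hsub : (M₁ ∪ M₂) \\ (M₁ ∪ M₂) ∪ (M₂ ∪ M₃) \\ (M₂ ∪ M₃) ∪ M₁ ⊼ M₃ ⊆ T := by
    intro G hG
    rw [mem_union, mem_union] at hG
    rcases hG with (hG | hG) | hG
    · -- differences inside the classes (a,b) ∪ (a,c)
      obtain ⟨C, hC, C', hC', rfl⟩ := mem_diffs.mp hG
      rw [mem_union] at hC hC'
      rcases hC with hC | hC <;> rcases hC' with hC' | hC'
      · obtain ⟨X, hX, rfl⟩ := mem_image.mp hC
        obtain ⟨Y, hY, rfl⟩ := mem_image.mp hC'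
        exact hdiff X (hD₁ X hX) Y (hD₁ Y hY) (h₁S X hX)
          (sdiff_sdiff_coGood S hf (h₁S X hX) (h₁i X hX) (h₁j X hX) (h₁i Y hY) (h₁j Y hY) hab.symm hab)
      · obtain ⟨X, hX, rfl⟩ := mem_image.mp hC
        obtain ⟨Y, hY, rfl⟩ := mem_image.mp hC'
        exact hdiff X (hD₁ X hX) Y (hD₂ Y hY) (h₁S X hX)
          (sdiff_sdiff_coGood S hf (h₁S X hX) (h₁i X hX) (h₁j X hX) (h₂i Y hY) (h₂j Y hY) hab.symm hac)
      · obtain ⟨X, hX, rfl⟩ := mem_image.mp hC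
        obtain ⟨Y, hY, rfl⟩ := mem_image.mp hC'
        exact hdiff X (hD₂ X hX) Y (hD₁ Y hY) (h₂S X hX)
          (sdiff_sdiff_coGood S hf (h₂S X hX) (h₂i X hX) (h₂j X hX) (h₁i Y hY) (h₁j Y hY) hac.symm hab)
      · obtain ⟨X, hX, rfl⟩ := mem_image.mp hC
        obtain ⟨Y, hY, rfl⟩ := mem_image.mp hC'
        exact hdiff X (hD₂ X hX) Y (hD₂ Y hY) (h₂S X hX)
          (sdiff_sdiff_coGood S hf (h₂S X hX) (h₂i X hX) (h₂j X hX) (h₂i Y hY) (h₂j Y hY) hac.symm hac)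
    · -- differences inside the classes (a,c) ∪ (b,c)
      obtain ⟨C, hC, C', hC', rfl⟩ := mem_diffs.mp hG
      rw [mem_union] at hC hC'
      rcases hC with hC | hC <;> rcases hC' with hC' | hC'
      · obtain ⟨X, hX, rfl⟩ := mem_image.mp hC
        obtain ⟨Y, hY, rfl⟩ := mem_image.mp hC'
        exact hdiff X (hD₂ X hX) Y (hD₂ Y hY) (h₂S X hX)
          (sdiff_sdiff_coGood S hf (h₂S X hX) (h₂i X hX) (h₂j X hX) (h₂i Y hY) (h₂j Y hY) hac.symm hac)
      · obtain ⟨X, hX, rfl⟩ := mem_image.mp hC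
        obtain ⟨Y, hY, rfl⟩ := mem_image.mp hC'
        exact hdiff X (hD₂ X hX) Y (hD₃ Y hY) (h₂S X hX)
          (sdiff_sdiff_coGood S hf (h₂S X hX) (h₂i X hX) (h₂j X hX) (h₃i Y hY) (h₃j Y hY) hbc.symm hac)
      · obtain ⟨X, hX, rfl⟩ := mem_image.mp hC
        obtain ⟨Y, hY, rfl⟩ := mem_image.mp hC'
        exact hdiff X (hD₃ X hX) Y (hD₂ Y hY) (h₃S X hX)
          (sdiff_sdiff_coGood S hf (h₃S X hX) (h₃i X hX) (h₃j X hX) (h₂i Y hY) (h₂j Y hY) hac.symm hbc)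
      · obtain ⟨X, hX, rfl⟩ := mem_image.mp hC
        obtain ⟨Y, hY, rfl⟩ := mem_image.mp hC'
        exact hdiff X (hD₃ X hX) Y (hD₃ Y hY) (h₃S X hX)
          (sdiff_sdiff_coGood S hf (h₃S X hX) (h₃i X hX) (h₃j X hX) (h₃i Y hY) (h₃j Y hY) hbc.symm hbc)
    · -- meets between the classes (a,b) and (b,c)
      obtain ⟨C, hC, C', hC', hCC'⟩ := mem_infs.mp hG
      obtain ⟨X, hX, rfl⟩ := mem_image.mp hC
      obtain ⟨Z, hZ, rfl⟩ := mem_image.mp hC'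
      rw [← hCC', inf_eq_inter]
      exact hmeet X (hD₁ X hX) Z (hD₃ Z hZ)
        (inter_coGood S hf (h₁S X hX) (h₃S Z hZ) (h₁i X hX) (h₁j X hX) (h₃i Z hZ) (h₃j Z hZ) hbc hab)
  exact hMS3.trans (card_le_card hsub)

/-- **Conditional form: `MS3′ ⟹ W2` for the transitive triangle.**  Assume the three-family Marica–Schönheim inequality `MS3′`
(for pairwise disjoint families `P, Q, R` of sets with `p ∩ r ≠ ∅` for `p ∈ P`, `r ∈ R`, the differences inside `P ∪ Q` and inside
`Q ∪ R` together with the meets `p ∩ r` number at least `#P + #Q + #R`).  Then every co-intersecting family of bads of the three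
types `(a,b), (a,c), (b,c)` (`a,b,c` distinct; members of `(a,b)`- and `(b,c)`-bads intersect) satisfies the W2 count. -/
theorem card_le_card_wordsTwo_of_transitiveTriangle_of_MS3 (S : Finset α) {f : Finset α → Lab k}
    (hMS3 : ∀ P Q R : Finset (Finset α), Disjoint P Q → Disjoint Q R → Disjoint P R →
      (∀ p ∈ P, ∀ r ∈ R, (p ∩ r).Nonempty) →
      #P + #Q + #R ≤ #((P ∪ Q) \\ (P ∪ Q) ∪ (Q ∪ R) \\ (Q ∪ R) ∪ P ⊼ R))
    (hf : ∀ ⦃U V : Finset α⦄, U ⊆ V → f U ≤ f V) (D₁ D₂ D₃ : Finset (Finset α)) {a b c : Fin k}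
    (hab : a ≠ b) (hac : a ≠ c) (hbc : b ≠ c)
    (h₁S : ∀ X ∈ D₁, X ⊆ S) (h₁i : ∀ X ∈ D₁, f X = petal a) (h₁j : ∀ X ∈ D₁, f (S \ X) = petal b)
    (h₂S : ∀ Y ∈ D₂, Y ⊆ S) (h₂i : ∀ Y ∈ D₂, f Y = petal a) (h₂j : ∀ Y ∈ D₂, f (S \ Y) = petal c)
    (h₃S : ∀ Z ∈ D₃, Z ⊆ S) (h₃i : ∀ Z ∈ D₃, f Z = petal b) (h₃j : ∀ Z ∈ D₃, f (S \ Z) = petal c)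
    (hCoI : ∀ X ∈ D₁, ∀ Z ∈ D₃, ¬ S \ X ⊆ Z) :
    #D₁ + #D₂ + #D₃ ≤ #{G ∈ S.powerset | f G = bot ∧ f (S \ G) = top ∧
      ∃ X ∈ D₁ ∪ D₂ ∪ D₃, ∃ Y ∈ D₁ ∪ D₂ ∪ D₃, G = (S \ X) \ (S \ Y) ∨ G = (S \ X) ∩ (S \ Y)} := by
  classical
  refine card_le_card_wordsTwo_of_transitiveTriangle S hf D₁ D₂ D₃ hab hac hbc h₁S h₁i h₁j h₂S h₂i h₂j h₃S h₃i h₃j ?_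
  set M₁ : Finset (Finset α) := D₁.image fun X => S \ X with hM₁
  set M₂ : Finset (Finset α) := D₂.image fun X => S \ X with hM₂
  set M₃ : Finset (Finset α) := D₃.image fun X => S \ X with hM₃
  -- complementation inside `S` is injective on each class
  have hinj : ∀ D : Finset (Finset α), (∀ X ∈ D, X ⊆ S) → #(D.image fun X => S \ X) = #D := by
    intro D hDS
    refine card_image_of_injOn ?_
    intro X hX X' hX' h
    have e₁ := Finset.sdiff_sdiff_eq_self (hDS X hX)
    have e₂ := Finset.sdiff_sdiff_eq_self (hDS X' hX')
    simp only at h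
    rw [← e₁, ← e₂, h]
  -- a member of one class is never a member of another class (its label or its complement's label differ)
  have hne₁₂ : ∀ X ∈ D₁, ∀ Y ∈ D₂, S \ X ≠ S \ Y := by
    intro X hX Y hY h
    have := (h₁j X hX).symm.trans (h ▸ h₂j Y hY)
    exact hbc (Lab.petal.inj this)
  have hne₂₃ : ∀ Y ∈ D₂, ∀ Z ∈ D₃, S \ Y ≠ S \ Z := by
    intro Y hY Z hZ h
    have e₁ := Finset.sdiff_sdiff_eq_self (h₂S Y hY)
    have e₂ := Finset.sdiff_sdiff_eq_self (h₃S Z hZ)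
    have hYZ : Y = Z := by rw [← e₁, ← e₂, h]
    have := (h₂i Y hY).symm.trans (hYZ ▸ h₃i Z hZ)
    exact hab (Lab.petal.inj this)
  have hne₁₃ : ∀ X ∈ D₁, ∀ Z ∈ D₃, S \ X ≠ S \ Z := by
    intro X hX Z hZ h
    have := (h₁j X hX).symm.trans (h ▸ h₃j Z hZ)
    exact hbc (Lab.petal.inj this)
  have hdisj : ∀ (Da Db : Finset (Finset α)), (∀ X ∈ Da, ∀ Y ∈ Db, S \ X ≠ S \ Y) →
      Disjoint (Da.image fun X => S \ X) (Db.image fun X => S \ X) := by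
    intro Da Db hne
    rw [Finset.disjoint_left]
    intro C hCa hCb
    obtain ⟨X, hX, rfl⟩ := mem_image.mp hCa
    obtain ⟨Y, hY, hYX⟩ := mem_image.mp hCb
    exact hne X hX Y hY hYX.symm
  have h := hMS3 M₁ M₂ M₃ (hdisj D₁ D₂ hne₁₂) (hdisj D₂ D₃ hne₂₃) (hdisj D₁ D₃ hne₁₃) (by
    intro p hp r hr
    obtain ⟨X, hX, rfl⟩ := mem_image.mp hp
    obtain ⟨Z, hZ, rfl⟩ := mem_image.mp hr
    -- `(S \ X) ∩ (S \ Z)` is nonempty by co-intersection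
    rw [Finset.nonempty_iff_ne_empty]
    intro hempty
    apply hCoI X hX Z hZ
    intro x hx
    by_contra hxZ
    have hmem : x ∈ (S \ X) ∩ (S \ Z) := mem_inter.mpr ⟨hx, mem_sdiff.mpr ⟨(mem_sdiff.mp hx).1, hxZ⟩⟩
    rw [hempty] at hmem
    simp at hmem)
  rw [hinj D₁ h₁S, hinj D₂ h₂S, hinj D₃ h₃S] at h
  exact h

end OrientedAntipodalHall

end Summit.CriticalPhenomena.PercolationContinuityZ3.Theorems
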